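import Literature.NumberTheory.GelbartRogawski1991.DoubledKroneckerConjugation
import Literature.NumberTheory.GelbartRogawski1991.CompatibleSplittingCMDoubling
import Literature.NumberTheory.Automorphic.UnitaryGroupLevelTransport
import HarnessLib

/-!
# The doubled Kronecker conjugation datum (IV): the head adapters at a rational frame `B` — `a := B⁻¹ ⊗ 1` from
# `hB : formCongr c̄ B (1 • diag dV′) = diag dV` — and the finite part `thetaF = finAdelicCongr (kronAD e B⁻¹)` of `θ^𝔻`

Cell `hodgecm-mathlib`, GS-6 (β) glue, node (T) «frame independence of `ω(μ,ε,χ)`», piece (T1ᴰ) = the MODEL INSTANTIATION of the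
doubled conjugation datum (placement row L-13b, wave 2).  Phase-A bytes of record: `A-plan/gs6-glue/T1D-modelInstantiation.A-p06g11.lean`
v3 sha16 54c3fde381223f81 (A-p06 g11; heir A-p15 g8, v4 117472700602f9d5), declarations byte-identical up to (i) `[folklore]` → `[cite:]`
docstring tags and (ii) the local notations `𝔸⁺`/`𝔸L` expanded to `(AdeleRing (𝓞 (Fp L)) (Fp L))`/`(AdeleRing (𝓞 L) L)` (no notation in
Literature files).  HC_CM is proved only modulo the 7 printed citations until rung 0 closes.

THE MODEL.  CM field `L`, `L⁺ = Fp L`, frames `dV, dV′ : Fin N → L` (two hermitian structures on `V`), `dW : Fin M → L`, enumeration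
`e : Fin N × Fin M ≃ Fin n`; an adelic isometry `a : (V ⊗ 𝔸, diag dV′) ≅ (V ⊗ 𝔸, diag dV)` (`ha`), rational (`a = a₀ ⊗ 1`, `haa₀`), and a
relabelling `C ∈ GL_{N M}(𝔸_{L⁺})`, `(T_V ⊗ T_W) C = T_V′ ⊗ T_W` (`hC`), rational (`C = C₀ ⊗ 1`, `hCC₀`).

* §6 HEAD ADAPTERS for the socket datum (`B : GL_N(L)`, `hB : formCongr c̄ B (1 • diag dV′) = diag dV`, an ISOMETRY — `b = 1`):
  `isometry_inv_of_formCongr`, **`aOfB L B := (algebraMap L 𝔸_L)_* B⁻¹`** (`coe_aOfB` = `haa₀` with `a₀ := B⁻¹`, `aOfB_isometry` = `ha`),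
  `adelicPairIsometryConjLeft_aOfB_adelicInl/Inr` (the `hθinl/hθinr` of the frame-transport head with `θ := adelicPairIsometryConjLeft (aOfB L B) …`,
  `φ := (finAdelicCongr B one_ne_zero hB).symm`), `adelicIsometryConj_aOfB_finAdelicToAdelic`;
* §7 the FINITE PART of `θ^𝔻` (over ★ `hermD_eq`): `kronAD_isometry_rat`, `formCongr_kronAD_inv`, **`thetaF := finAdelicCongr (kronAD e B⁻¹)`**,
  `continuous_thetaF`, `coe_thetaF`, `kronAD_aOfB`, **`thetaD_finAdelicToAdelic`**: `θ^𝔻 (1, k) = (1, θ_f k)`.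

## References

* [Kudla1984] S. Kudla, *Seesaw dual reductive pairs*, Progr. Math. 46 (1984), §1.
* [Kudla1994] S. S. Kudla, *Splitting metaplectic covers of dual reductive pairs*, Israel J. Math. 87 (1994), §2, Thm. 3.1.
* [GelbartRogawski1991] S. Gelbart, J. Rogawski, Invent. Math. 105 (1991), §3.1 p. 454, Prop. 3.1.1 p. 455.
* [Weil1964] A. Weil, Acta Math. 111 (1964), Chap. III n° 40 p. 190, n° 41 Thm 6 p. 193 (rational lifts fix `Θ`).
* [MoeglinVignerasWaldspurger1987] C. Mœglin, M.-F. Vignéras, J.-L. Waldspurger, LNM 1291 (1987), Chap. 2 II.1.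
* [PlatonovRapinchuk1994] V. Platonov, A. Rapinchuk, *Algebraic Groups and Number Theory* (1994), §2.3, §5.1.
-/

set_option autoImplicit false

noncomputable section

open scoped Classical
open scoped Matrix Kronecker
open NumberField IsDedekindDomain
open Literature.RepresentationTheory.HeisenbergGroup
open Literature.RepresentationTheory.HeisenbergGroup.SymplecticMatrix (transportSp mapHom)
open Literature.NumberTheory.Automorphic
open Literature.NumberTheory.Weil1964
open Literature.NumberTheory.GaloisRepresentations

namespace Literature.NumberTheory.GelbartRogawski1991.GRConstruction

open UnitaryDualPair
open Literature.NumberTheory.Automorphic.UnitaryGroup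

variable (L : Type) [Field L] [NumberField L] [IsCMField L]
  {N M n : ℕ} (e : Fin N × Fin M ≃ Fin n)
  (dV : Fin N → L) (hdV : ∀ i, IsCMField.complexConj L (dV i) = dV i) (hdV0 : ∀ i, dV i ≠ 0)
  (dV' : Fin N → L) (hdV' : ∀ i, IsCMField.complexConj L (dV' i) = dV' i) (hdV'0 : ∀ i, dV' i ≠ 0)
  (dW : Fin M → L) (hdW : ∀ i, IsCMField.complexConj L (dW i) = dW i) (hdW0 : ∀ i, dW i ≠ 0)

/-! # §6 Head adapters for the (T) socket datum: `a := B⁻¹ ⊗ 1` from `hB : formCongr c̄ B (1 • diag dV′) = diag dV`, and the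
`hθinl` / `hθinr` clauses of A-p02's T-head 896a65e3 :195 with `θ := adelicPairIsometryConjLeft a ha`, `φ := (finAdelicCongr B …).symm` -/

section HeadAdapters

variable (B : GL (Fin N) L)

/-- **`a₀ := B⁻¹` is a rational isometry `(V, diag dV′) ≅ (V, diag dV)`**: `ᵗ(c̄ B⁻¹) · diag dV · B⁻¹ = diag dV′`
(★ `isometry_inv` on the socket's `hB`). [cite: PlatonovRapinchuk1994, §2.3] -/
theorem isometry_inv_of_formCongr
    (hB : formCongr ((IsCMField.complexConj L : L ≃ₐ[Fp L] L) : L →+* L) B ((1 : L) • Matrix.diagonal dV') =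
      Matrix.diagonal dV) :
    ((((B⁻¹ : GL (Fin N) L)) : Matrix (Fin N) (Fin N) L).map ((IsCMField.complexConj L : L ≃ₐ[Fp L] L) : L →+* L))ᵀ *
        Matrix.diagonal dV * ((B⁻¹ : GL (Fin N) L) : Matrix (Fin N) (Fin N) L) = Matrix.diagonal dV' := by
  have hB' := hB
  rw [one_smul] at hB'
  exact isometry_inv _ B hB'

/-- **the adelic isometry `a := B⁻¹ ⊗ 1 ∈ GL_N(𝔸_L)`** of the socket datum. [cite: PlatonovRapinchuk1994, §5.1] -/
def aOfB : GL (Fin N) (AdeleRing (𝓞 L) L) :=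
  Matrix.GeneralLinearGroup.map (algebraMap L (AdeleRing (𝓞 L) L)) B⁻¹

omit [IsCMField L] in
/-- `a = a₀ ⊗ 1` with `a₀ = B⁻¹` (the `haa₀` of §4–§5; definitional). [cite: PlatonovRapinchuk1994, §5.1] -/
theorem coe_aOfB :
    ((aOfB L B : GL (Fin N) (AdeleRing (𝓞 L) L)) : Matrix (Fin N) (Fin N) (AdeleRing (𝓞 L) L)) =
      ((B⁻¹ : GL (Fin N) L) : Matrix (Fin N) (Fin N) L).map (algebraMap L (AdeleRing (𝓞 L) L)) :=
  rfl

/-- **`a` is an adelic isometry `(V ⊗ 𝔸, diag dV′) ≅ (V ⊗ 𝔸, diag dV)`** (the `ha` of §2–§5; ★ `isometry_map` along `L → 𝔸_L`,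
`algebraMap_conj`). [cite: PlatonovRapinchuk1994, §5.1] -/
theorem aOfB_isometry
    (hB : formCongr ((IsCMField.complexConj L : L ≃ₐ[Fp L] L) : L →+* L) B ((1 : L) • Matrix.diagonal dV') =
      Matrix.diagonal dV) :
    (((aOfB L B : GL (Fin N) (AdeleRing (𝓞 L) L)) : Matrix (Fin N) (Fin N) (AdeleRing (𝓞 L) L)).map (conjAdele (Fp L) L (IsCMField.complexConj L)))ᵀ *
        adelicForm L N (Matrix.diagonal dV) * (aOfB L B : GL (Fin N) (AdeleRing (𝓞 L) L)) = adelicForm L N (Matrix.diagonal dV') :=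
  isometry_map (algebraMap L (AdeleRing (𝓞 L) L)) (fun x => algebraMap_conj (Fp L) L (IsCMField.complexConj L) x)
    (isometry_inv_of_formCongr L dV dV' B hB)

variable (hB : formCongr ((IsCMField.complexConj L : L ≃ₐ[Fp L] L) : L →+* L) B ((1 : L) • Matrix.diagonal dV') =
    Matrix.diagonal dV)

/-- **`hθinr` of the T-head contract**: `θ (1 ⊗ u_f) = 1 ⊗ u_f` for `θ = Ad(a ⊗ 1)`. [cite: Kudla1984, §1] -/
theorem adelicPairIsometryConjLeft_aOfB_adelicInr {M : ℕ} (JW : Matrix (Fin M) (Fin M) L)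
    (u : finAdelic (Fp L) L (IsCMField.complexConj L) M JW) :
    adelicPairIsometryConjLeft (Fp L) L (IsCMField.complexConj L) N M (aOfB L B) (aOfB_isometry L dV dV' B hB)
        (adelicInr (Fp L) L (IsCMField.complexConj L) N M (Matrix.diagonal dV') JW
          (finAdelicToAdelic (Fp L) L (IsCMField.complexConj L) M JW u)) =
      adelicInr (Fp L) L (IsCMField.complexConj L) N M (Matrix.diagonal dV) JW
        (finAdelicToAdelic (Fp L) L (IsCMField.complexConj L) M JW u) :=
  adelicPairIsometryConjLeft_adelicInr (Fp L) L (IsCMField.complexConj L) N M _ _ _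

/-- **conjugating a finite-adelic point by the rational `a = B⁻¹ ⊗ 1` IS the socket's `φ = (finAdelicCongr B)⁻¹`**:
`a · (1, k′) · a⁻¹ = (1, B_f⁻¹ k′ B_f)` in `U(diag dV)(𝔸)` (archimedean part `B⁻¹ 1 B = 1`, finite part `B_f⁻¹ k′ B_f`).
[cite: PlatonovRapinchuk1994, §5.1] -/
theorem adelicIsometryConj_aOfB_finAdelicToAdelic (k' : finAdelic (Fp L) L (IsCMField.complexConj L) N (Matrix.diagonal dV')) :
    adelicIsometryConj (Fp L) L (IsCMField.complexConj L) N (aOfB L B) (aOfB_isometry L dV dV' B hB)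
        (finAdelicToAdelic (Fp L) L (IsCMField.complexConj L) N (Matrix.diagonal dV') k') =
      finAdelicToAdelic (Fp L) L (IsCMField.complexConj L) N (Matrix.diagonal dV)
        ((finAdelicCongr (Fp L) L (IsCMField.complexConj L) B one_ne_zero hB).symm k') := by
  refine Subtype.ext (Units.ext (matrix_adele_ext L N ?_ ?_))
  · -- archimedean parts: `B⁻¹ · 1 · B = 1`
    show ((aOfB L B : GL (Fin N) (AdeleRing (𝓞 L) L)) * GLn.ofFinite N L (k' : GL (Fin N) (FiniteAdeleRing (𝓞 L) L)) *
        (aOfB L B)⁻¹).val.map (adeleFst L) =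
      (GLn.ofFinite N L (((finAdelicCongr (Fp L) L (IsCMField.complexConj L) B one_ne_zero hB).symm k' :
        finAdelic (Fp L) L (IsCMField.complexConj L) N (Matrix.diagonal dV)) : GL (Fin N) (FiniteAdeleRing (𝓞 L) L))).val.map
        (adeleFst L)
    rw [Units.val_mul, Units.val_mul, Matrix.map_mul, Matrix.map_mul, map_fst_ofFinite, map_fst_ofFinite, Matrix.mul_one,
      ← Matrix.map_mul, ← Units.val_mul, mul_inv_cancel, Units.val_one, Matrix.map_one _ (map_zero _) (map_one _)]
  · -- finite parts: `B_f⁻¹ · k′ · B_f`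
    show ((aOfB L B : GL (Fin N) (AdeleRing (𝓞 L) L)) * GLn.ofFinite N L (k' : GL (Fin N) (FiniteAdeleRing (𝓞 L) L)) *
        (aOfB L B)⁻¹).val.map (adeleSnd L) =
      (GLn.ofFinite N L (((finAdelicCongr (Fp L) L (IsCMField.complexConj L) B one_ne_zero hB).symm k' :
        finAdelic (Fp L) L (IsCMField.complexConj L) N (Matrix.diagonal dV)) : GL (Fin N) (FiniteAdeleRing (𝓞 L) L))).val.map
        (adeleSnd L)
    rw [Units.val_mul, Units.val_mul, Matrix.map_mul, Matrix.map_mul, map_snd_ofFinite, map_snd_ofFinite,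
      coe_finAdelicCongr_symm_apply, ← map_inv, Units.val_mul, Units.val_mul, aOfB, ← map_inv, inv_inv]
    rfl

/-- **`hθinl` of the T-head contract**: `θ (k′_f ⊗ 1) = (φ k′)_f ⊗ 1` with `θ = Ad(a ⊗ 1)`, `φ = (finAdelicCongr B)⁻¹`.
[cite: Kudla1984, §1] [cite: PlatonovRapinchuk1994, §5.1] -/
theorem adelicPairIsometryConjLeft_aOfB_adelicInl {M : ℕ} (JW : Matrix (Fin M) (Fin M) L)
    (k' : finAdelic (Fp L) L (IsCMField.complexConj L) N (Matrix.diagonal dV')) :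
    adelicPairIsometryConjLeft (Fp L) L (IsCMField.complexConj L) N M (aOfB L B) (aOfB_isometry L dV dV' B hB)
        (adelicInl (Fp L) L (IsCMField.complexConj L) N M (Matrix.diagonal dV') JW
          (finAdelicToAdelic (Fp L) L (IsCMField.complexConj L) N (Matrix.diagonal dV') k')) =
      adelicInl (Fp L) L (IsCMField.complexConj L) N M (Matrix.diagonal dV) JW
        (finAdelicToAdelic (Fp L) L (IsCMField.complexConj L) N (Matrix.diagonal dV)
          ((finAdelicCongr (Fp L) L (IsCMField.complexConj L) B one_ne_zero hB).symm k')) := by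
  rw [adelicPairIsometryConjLeft_adelicInl, adelicIsometryConj_aOfB_finAdelicToAdelic]

end HeadAdapters

/-! # §7 B-p02's `θf / hθf`: the FINITE PART of `θ^𝔻` is `finAdelicCongr` by the rational doubled matrix `kronAD e B⁻¹` -/

section FinitePart

variable (B : GL (Fin N) L)

-- (`J^𝔻 = reindex_{e₂} (reindex_e (diag dV ⊗ diag dW) ⊕ −(…))` over `L` is ★ `hermD_eq` of `CompatibleSplittingCMDoubling`; the phase-A copy
-- `hermD_eq_reindex_fromBlocks` is dropped for it — gate `dedup.landed`.)
/-- **the rational doubled matrix `kronAD e a₀` is an isometry `J^𝔻[dV′] → J^𝔻[dV]`** for a rational isometry `a₀ : diag dV′ → diag dV`.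
[cite: Kudla1994, §2 (doubled space, Siegel parabolic), Thm. 3.1] -/
theorem kronAD_isometry_rat (a₀ : GL (Fin N) L)
    (ha₀ : (((a₀ : GL (Fin N) L) : Matrix (Fin N) (Fin N) L).map ((IsCMField.complexConj L : L ≃ₐ[Fp L] L) : L →+* L))ᵀ *
        Matrix.diagonal dV * a₀ = Matrix.diagonal dV') :
    (((kronAD e a₀ : GL (Fin (n + n)) L) : Matrix (Fin (n + n)) (Fin (n + n)) L).map
          ((IsCMField.complexConj L : L ≃ₐ[Fp L] L) : L →+* L))ᵀ *
        hermD L e dV hdV dW hdW * (kronAD e a₀ : GL (Fin (n + n)) L) = hermD L e dV' hdV' dW hdW := by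
  rw [hermD_eq, hermD_eq]
  exact isometry_reindexGL _ _ _ (isometry_blockDiagGL _ _ _
    (isometry_reindexGL _ e _ (kroneckerGL_isometry_one _ a₀ ha₀ (Matrix.diagonal dW)))
    (isometry_neg _ (isometry_reindexGL _ e _ (kroneckerGL_isometry_one _ a₀ ha₀ (Matrix.diagonal dW)))))

/-- the socket's similitude hypothesis at the doubled level: `formCongr c̄ (kronAD e B⁻¹) (1 • J^𝔻[dV]) = J^𝔻[dV′]`.
[cite: PlatonovRapinchuk1994, §2.3] -/
theorem formCongr_kronAD_inv
    (hB : formCongr ((IsCMField.complexConj L : L ≃ₐ[Fp L] L) : L →+* L) B ((1 : L) • Matrix.diagonal dV') =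
      Matrix.diagonal dV) :
    formCongr ((IsCMField.complexConj L : L ≃ₐ[Fp L] L) : L →+* L) (kronAD e B⁻¹) ((1 : L) • hermD L e dV hdV dW hdW) =
      hermD L e dV' hdV' dW hdW := by
  rw [one_smul]
  exact kronAD_isometry_rat L e dV hdV dV' hdV' dW hdW B⁻¹ (isometry_inv_of_formCongr L dV dV' B hB)

variable (hB : formCongr ((IsCMField.complexConj L : L ≃ₐ[Fp L] L) : L →+* L) B ((1 : L) • Matrix.diagonal dV') =
    Matrix.diagonal dV)

/-- **`θ_f : H′(𝔸_f) →* H(𝔸_f)`, `k ↦ (kronAD e B⁻¹)_f · k · (kronAD e B⁻¹)_f⁻¹`** — the finite part of `θ^𝔻` (★ `finAdelicCongr`).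
[cite: PlatonovRapinchuk1994, §5.1] -/
def thetaF :
    finAdelic (Fp L) L (IsCMField.complexConj L) (n + n) (hermD L e dV' hdV' dW hdW) →*
      finAdelic (Fp L) L (IsCMField.complexConj L) (n + n) (hermD L e dV hdV dW hdW) :=
  (finAdelicCongr (Fp L) L (IsCMField.complexConj L) (kronAD e B⁻¹) one_ne_zero
    (formCongr_kronAD_inv L e dV hdV dV' hdV' dW hdW B hB)).toMonoidHom

/-- `θ_f` is continuous (B-p02's `hθfc`). [cite: PlatonovRapinchuk1994, §5.1] -/
theorem continuous_thetaF : Continuous (thetaF L e dV hdV dV' hdV' dW hdW B hB) :=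
  map_continuous (finAdelicCongr (Fp L) L (IsCMField.complexConj L) (kronAD e B⁻¹) one_ne_zero
    (formCongr_kronAD_inv L e dV hdV dV' hdV' dW hdW B hB))

/-- underlying element of `θ_f k`. [cite: PlatonovRapinchuk1994, §5.1] -/
theorem coe_thetaF (k : finAdelic (Fp L) L (IsCMField.complexConj L) (n + n) (hermD L e dV' hdV' dW hdW)) :
    ((thetaF L e dV hdV dV' hdV' dW hdW B hB k : finAdelic (Fp L) L (IsCMField.complexConj L) (n + n) (hermD L e dV hdV dW hdW)) :
        GL (Fin (n + n)) (FiniteAdeleRing (𝓞 L) L)) =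
      toFinAdeleGL L (n + n) (kronAD e B⁻¹) * (k : GL (Fin (n + n)) (FiniteAdeleRing (𝓞 L) L)) *
        (toFinAdeleGL L (n + n) (kronAD e B⁻¹))⁻¹ :=
  rfl

omit [IsCMField L] in
/-- `kronAD e (B⁻¹ ⊗ 1) = (kronAD e B⁻¹) ⊗ 1` as elements of `GL_{n+n}(𝔸_L)`. [cite: PlatonovRapinchuk1994, §5.1] -/
theorem kronAD_aOfB : kronAD e (aOfB L B) = Matrix.GeneralLinearGroup.map (algebraMap L (AdeleRing (𝓞 L) L)) (kronAD e B⁻¹) :=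
  Units.ext (coe_kronAD_map e (algebraMap L (AdeleRing (𝓞 L) L)) B⁻¹ (coe_aOfB L B))

/-- **B-p02's `hθf`: `θ^𝔻 (1, k) = (1, θ_f k)`** (archimedean part `g₀ · 1 · g₀⁻¹ = 1`, finite part `g₀,f k g₀,f⁻¹`).
[cite: PlatonovRapinchuk1994, §5.1] [cite: Kudla1994, §2 (doubled space, Siegel parabolic), Thm. 3.1] -/
theorem thetaD_finAdelicToAdelic (k : finAdelic (Fp L) L (IsCMField.complexConj L) (n + n) (hermD L e dV' hdV' dW hdW)) :
    thetaD L e dV hdV dV' hdV' dW hdW (aOfB L B) (aOfB_isometry L dV dV' B hB)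
        (finAdelicToAdelic (Fp L) L (IsCMField.complexConj L) (n + n) (hermD L e dV' hdV' dW hdW) k) =
      finAdelicToAdelic (Fp L) L (IsCMField.complexConj L) (n + n) (hermD L e dV hdV dW hdW)
        (thetaF L e dV hdV dV' hdV' dW hdW B hB k) := by
  refine Subtype.ext (Units.ext (matrix_adele_ext L (n + n) ?_ ?_))
  · show ((kronAD e (aOfB L B) : GL (Fin (n + n)) (AdeleRing (𝓞 L) L)) * GLn.ofFinite (n + n) L (k : GL (Fin (n + n)) (FiniteAdeleRing (𝓞 L) L)) *
        (kronAD e (aOfB L B))⁻¹).val.map (adeleFst L) =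
      (GLn.ofFinite (n + n) L ((thetaF L e dV hdV dV' hdV' dW hdW B hB k :
        finAdelic (Fp L) L (IsCMField.complexConj L) (n + n) (hermD L e dV hdV dW hdW)) :
          GL (Fin (n + n)) (FiniteAdeleRing (𝓞 L) L))).val.map (adeleFst L)
    rw [Units.val_mul, Units.val_mul, Matrix.map_mul, Matrix.map_mul, map_fst_ofFinite, map_fst_ofFinite, Matrix.mul_one,
      ← Matrix.map_mul, ← Units.val_mul, mul_inv_cancel, Units.val_one, Matrix.map_one _ (map_zero _) (map_one _)]
  · show ((kronAD e (aOfB L B) : GL (Fin (n + n)) (AdeleRing (𝓞 L) L)) * GLn.ofFinite (n + n) L (k : GL (Fin (n + n)) (FiniteAdeleRing (𝓞 L) L)) *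
        (kronAD e (aOfB L B))⁻¹).val.map (adeleSnd L) =
      (GLn.ofFinite (n + n) L ((thetaF L e dV hdV dV' hdV' dW hdW B hB k :
        finAdelic (Fp L) L (IsCMField.complexConj L) (n + n) (hermD L e dV hdV dW hdW)) :
          GL (Fin (n + n)) (FiniteAdeleRing (𝓞 L) L))).val.map (adeleSnd L)
    rw [Units.val_mul, Units.val_mul, Matrix.map_mul, Matrix.map_mul, map_snd_ofFinite, map_snd_ofFinite, coe_thetaF, ← map_inv,
      Units.val_mul, Units.val_mul, kronAD_aOfB, ← map_inv]
    rfl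

end FinitePart

end Literature.NumberTheory.GelbartRogawski1991.GRConstruction

end
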